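import Summits.Ventures.AbcSig.Rows.Statements
import Summits.Ventures.AbcSig.Rows.XnYn13Z2

/-!
# Venture AbcSig — CELL bridge for `xⁿ + yⁿ = 13 z²`: p1's census predicate `Rows.C1Cell 13 11 {11}`

HONEST FRAMING. COMPUTATION cell `pub-abcsig`; CONDITIONAL theorem; no claim on ABC or any summit. Hypotheses exactly
those of `Rows/XnYn13Z2.lean` (`row_XnYn13Z2`): `BS04Package` (CITED), `DataComplete` /
`Refines` (COMPUTED, certified level files), and the row's per-orbit CITED exclusions `hX_…` universally quantified in
the exponent. Conclusion = the census statement of the SIGNED row of record `census/rows/C1/C1-C13-all.md` in p1's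
vocabulary (`Rows/Statements.lean`): every prime `n ≥ 11`, `n ∤ 13`, no primitive solution with `|xy| > 1`.
GENERATED by p-lean gen3/make_c1cell.py (pattern of `Rows/BridgeC1P2.lean`).
-/

namespace Summit.Ventures.AbcSig

/-- `xⁿ + yⁿ = 13z²`, every prime `n ≥ 11` with `n ∤ 13`, `n ∉ {11}`: p1's `Rows.C1Cell 13 11 {11}` from `row_XnYn13Z2`. -/
theorem C1Cell_13_of (M : NewformModel) (hP : M.BS04Package)
    (hD338 : M.DataComplete 338 level338Orbits)
    (hD5408 : M.DataComplete 5408 level5408Orbits)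
    (hX_orbit_5408_6 : ∀ n : ℕ, M.Excludes 5408 orbit_5408_6 (fun S => S.A = 1 ∧ S.B = 1 ∧ S.C = 13 ∧ S.n = n ∧ ¬ 2 ∣ S.a * S.b))
    (hX_orbit_5408_7 : ∀ n : ℕ, M.Excludes 5408 orbit_5408_7 (fun S => S.A = 1 ∧ S.B = 1 ∧ S.C = 13 ∧ S.n = n ∧ ¬ 2 ∣ S.a * S.b))
    (hX_orbit_5408_8 : ∀ n : ℕ, M.Excludes 5408 orbit_5408_8 (fun S => S.A = 1 ∧ S.B = 1 ∧ S.C = 13 ∧ S.n = n ∧ ¬ 2 ∣ S.a * S.b)) :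
    Rows.C1Cell 13 11 {11} :=
  fun n hn h11 hC hR x y z _ _ =>
    row_XnYn13Z2 M hP hD338 hD5408 n hn h11 (by
      intro hmem
      simp only [List.mem_cons, List.not_mem_nil, or_false] at hmem
      rcases hmem with rfl | rfl
      · simp at hR
      · exact hC (by norm_num)) (hX_orbit_5408_6 n) (hX_orbit_5408_7 n) (hX_orbit_5408_8 n) x y z

end Summit.Ventures.AbcSig
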